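import Literature.AnabelianGeometry.EtaleTheta.GalSectCuspidalTorsors
import Literature.AnabelianGeometry.EtaleTheta.ConstantMultipleRigidity
import Mathlib.RingTheory.RootsOfUnity.PrimitiveRoots
import HarnessLib

/-!
# [GalSect] Def. 4.1 (ii)(iii) and Cor. 4.12: integral / discrete / tame structures on a cuspidal decomposition
# group, the canonical integral structure — and the two [EtTh] §1 consumers (Prop. 1.4 (iii), cusp clause;
# Thm. 1.10 (iii))

Mochizuki, *Galois sections in absolute anabelian geometry* [GalSect] (= [Mzk13] of [EtTh], [Mzk8] of
[SemiAnbd]), Nagoya Math. J. **179** (2005) 17–45, §4, Def. 4.1 (ii)(iii) p.34 and Cor. 4.12 pp.43–44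
[cite: MochizukiGalSect2005, Def 4.1 (ii) p.34]; consumed by Mochizuki, *The étale theta function …* [EtTh],
Publ. RIMS **45** (2009), Prop. 1.4 (iii) p.248 (PRIMS PDF p.22) and Thm. 1.10 (iii) p.256 (PDF p.30)
[cite: MochizukiEtTh2009, Thm 1.10 (iii) p.30].  abc-iut cell, layer L2, row «N5 UNBLOCK [GalSect] §4
vocabulary» (abc-iut-L2-lead gen 2, 2026-08-26T02:50:10Z; seat abc-iut-w5-d062 gen 2); FILE 2 of 2, over
`GalSectCuspidalTorsors.lean` (the torsor of splitting classes `SplittingClass X x`, its structure group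
`KxHat X = (K^×)^∧`, `CuspidalTorsorData`, the `A`-torsors `ATorsor φ`, `IsTorsorStructure`, `IsStructure`).
STATEMENTS-FIRST (review lane): predicates, data structures with printed properties, ONE zero-argument named
fact (`GalSect.GalSectCor412`, NEVER asserted; a published refereed prerequisite outside the [IUTchIII]
Cor. 3.12 cone, typed after the FACT-LIST freeze ⇒ recorded in plan/GAP-LEDGER.md and NOT consumable by the
13:00Z adjudication).

**[GalSect] Def. 4.1 (verbatim).** "(ii) A `O_K^×`- (respectively, `K^×`-) torsor structure on the
`(K^×)^∧`-torsor at `x` will be referred to as a(n) integral (respectively, discrete) structure on the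
cuspidal decomposition group `D_x`. … think of `(K^×)^∧ ⊗ Ẑ′` as a quotient of `(K^×)^∧` [`Ẑ′ := Ẑ/ℤ_p`] …
a `(O_K^×)′`- (respectively, `(K^×)′`-) torsor structure on the `(K^×)^∧ ⊗ Ẑ′`-torsor at `x` will be referred
to as a(n) tame integral (respectively, tame discrete) structure … (iii) If `X_K` has stable reduction over
`O_K` (respectively, `X_K` is arbitrary), then the particular integral (respectively, discrete) structure on
`D_x` arising … from a generator of the rank one free `O_K`-submodule of `ω_x` determined by the stable
reduction of `X_K` (respectively, any nonzero element of `ω_x`) will be referred to as the canonical integral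
(respectively, discrete) structure on … `D_x`. The canonical integral (respectively, discrete) structure on
`D_x` induces a tame integral (respectively, tame discrete) structure on `D_x` which we shall also refer to
as canonical."

## How it is typed (read with the referee)

* Def. 4.1 (ii): predicates on sets of splitting classes / of points of the `A`-torsor (FILE 1); the tame
  quotient `(K^×)^∧ ↠ (K^×)^∧ ⊗ Ẑ′` enters as a PARAMETER `τ` (any realisation), not as data.
* Def. 4.1 (iii): the canonical structures themselves are layer L3's interface data
  (`SemiGraphs.CuspidalStructures.canonicalIntegral / canonicalDiscrete`, sets of splitting subgroups,
  cited, not restated); here the BRIDGE predicate `IsCanonicalFor` ("those sets ARE an integral / the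
  discrete structure, saturated under `I_x`") and the induced canonical tame structures.
* Cor. 4.12 over L3's profinite reading of Def. 4.1 (iv) (`decompHat`, `hatOf`), WITH the printed ERRATUM
  of [EtTh] Rmk. 1.10.1 (ii) ("the author omitted the hypothesis that '`K` contain a primitive 12-th root of
  unity'"; author's comments file item (2)) carried as a hypothesis.
* [EtTh] consumers: `ThetaSetting.CuspidalPointDd` + `Prop14iiiCuspValues` (Prop. 1.4 (iii), cusp clause —
  «not typed» in `ThetaCohomology.lean`) and `Thm110iii` over `MuTwoSetting` / `Thm110Hypothesis`
  (Thm. 1.10 (iii) — «NOT typed (deferred)» in `ConstantMultipleRigidity.lean`).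

READING NOTES (recorded, not resolved). (R2) [EtTh] Prop. 1.4 (iii) cusp clause: the "value" of `Θ̈` at a
cusp `y` with `Ü(y) = c = ±q̈^a` read through the canonical integral structure is the leading coefficient of
`Θ̈` in the canonical coordinate `t = Ü/c − 1` of the stable model (unit coordinate `Ü/q̈^a` on the
irreducible component labelled `a`, [EtTh] p.247), i.e. `c · Θ̈′(c)`, of absolute value `‖2‖·‖q̈‖^{−a²}` (tree:
`norm_deriv_thetaDdot_zpow`, abc-iut-L2-t6); the statement is up to `O^×_K̈`, so only this normalisation
(not the unit) matters — it is OUR reading of "a similar statement holds", flagged here.  (R3) As L2's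
`NonCuspidalPoint`, the cusp clause is typed for `L = K̈` only.
-- TODO(general form): [EtTh] Prop. 1.4 (iii) for cusps `y ∈ Ÿ(L)`, `L ⊋ K̈` finite.
HONEST FRAMING: [GalSect] and [EtTh] are refereed papers; nothing printed is asserted; typed ≠ proved; the
abc-iut cell takes no side on [IUTchIII] Cor. 3.12, on which nothing here bears.
-/

noncomputable section

open scoped Pointwise

namespace Literature.AnabelianGeometry.EtaleTheta

open Literature.AnabelianGeometry.SemiGraphs

namespace GalSect

variable {p : ℕ} [Fact p.Prime]

namespace CuspidalTorsorData

variable {X : TemperedCurve p} {x : X.Pt} (T : CuspidalTorsorData X x)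

/-! ### Def. 4.1 (ii): integral / discrete / tame structures on `D_x` -/

/-- **Def. 4.1 (ii), integral structure** on `D_x`: an `O_K^×`-torsor structure on the `(K^×)^∧`-torsor at
`x`. [cite: MochizukiGalSect2005, Def 4.1 (ii) p.34] -/
def IsIntegralStructure (R : Set (SplittingClass X x)) : Prop := T.IsStructure (unitsHat X) R

/-- **Def. 4.1 (ii), discrete structure** on `D_x`: a `K^×`-torsor structure on the `(K^×)^∧`-torsor at `x`.
[cite: MochizukiGalSect2005, Def 4.1 (ii) p.34] -/
def IsDiscreteStructure (R : Set (SplittingClass X x)) : Prop := T.IsStructure (discreteHat X) R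

/-- **Def. 4.1 (ii), tame integral structure** on `D_x`: an `(O_K^×)′`-torsor structure on the
`(K^×)^∧ ⊗ Ẑ′`-torsor at `x`, `(O_K^×)′ :=` the image of `O_K^×` — relative to a realisation
`τ : (K^×)^∧ ↠ (K^×)^∧ ⊗ Ẑ′` of "`(K^×)^∧ ⊗ Ẑ′` as a quotient of `(K^×)^∧`" (`Ẑ′ = Ẑ/ℤ_p`; the quotient by
the pro-`p` part is not constructed here — PARAMETER). [cite: MochizukiGalSect2005, Def 4.1 (ii) p.34] -/
def IsTameIntegralStructure {A : Type*} [Group A] (τ : KxHat X →* A) (R : Set (T.ATorsor τ)) : Prop :=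
  T.IsTorsorStructure τ ((unitsHat X).map τ) R

/-- **Def. 4.1 (ii), tame discrete structure** on `D_x`: a `(K^×)′`-torsor structure on the
`(K^×)^∧ ⊗ Ẑ′`-torsor at `x`, `(K^×)′ :=` the image of `K^×` (relative to a realisation `τ` of the tame
quotient, as above). [cite: MochizukiGalSect2005, Def 4.1 (ii) p.34] -/
def IsTameDiscreteStructure {A : Type*} [Group A] (τ : KxHat X →* A) (R : Set (T.ATorsor τ)) : Prop :=
  T.IsTorsorStructure τ ((discreteHat X).map τ) R

/-- An integral structure refines a unique discrete structure (`O_K^× ⊆ K^×`): the `K^×`-orbit it spans.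
[cite: MochizukiGalSect2005, Def 4.1 (ii) p.34] -/
def discreteOf (R : Set (SplittingClass X x)) : Set (SplittingClass X x) :=
  {c' | ∃ c ∈ R, ∃ b ∈ discreteHat X, c' = T.act b c}

/-- The tame structure induced by a `B`-structure on the `(K^×)^∧`-torsor: its image in the
`(K^×)^∧ ⊗ Ẑ′`-torsor (realised through `τ`), saturated under the image group `τ(B)` ("induces a tame
integral (respectively, tame discrete) structure", Def. 4.1 (iii), p.34). [cite: MochizukiGalSect2005, Def 4.1 (iii) p.34] -/
def tameOf {A : Type*} [Group A] (τ : KxHat X →* A) (B : Subgroup (KxHat X))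
    (R : Set (SplittingClass X x)) : Set (T.ATorsor τ) :=
  {s | ∃ c ∈ R, ∃ b ∈ B.map τ, s = ATorsor.act T τ b (ATorsor.ofClass T τ c)}

/-! ### Def. 4.1 (iii): the canonical structures — bridge to layer L3's `CuspidalStructures` -/

/-- **Def. 4.1 (iii) read on L3's data**: the sets `canonicalIntegral x ⊆ canonicalDiscrete x` of
`SX : CuspidalStructures X` (recorded there as sets of splitting subgroups) ARE an integral, resp. the
discrete structure it refines, on `D_x` in the sense of Def. 4.1 (ii) — the integral clause under "`X_K`
has stable reduction over `O_K`", the discrete one for "`X_K` arbitrary"; and the subgroup sets are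
saturated under `I_x`-conjugation (they are unions of classes).  A compatibility PREDICATE between the two
interface data (certified together by the origin predicates), not an assertion.
[cite: MochizukiGalSect2005, Def 4.1 (iii) p.34] -/
structure IsCanonicalFor (SX : CuspidalStructures X) : Prop where
  /-- the canonical discrete structure is a discrete structure (any `X_K`, `x` a `K`-rational cusp) -/
  discrete : X.IsCusp x → X.IsRationalPt x → T.IsDiscreteStructure (classesOf (SX.canonicalDiscrete x))
  /-- under stable reduction the canonical integral structure is an integral structure … -/
  integral : SX.HasStableReduction → X.IsCusp x → X.IsRationalPt x →
    T.IsIntegralStructure (classesOf (SX.canonicalIntegral x))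
  /-- … refining the canonical discrete one -/
  discreteOf_integral : SX.HasStableReduction → X.IsCusp x → X.IsRationalPt x →
    T.discreteOf (classesOf (SX.canonicalIntegral x)) = classesOf (SX.canonicalDiscrete x)
  /-- the recorded sets of splittings are unions of `I_x`-conjugacy classes -/
  saturated : ∀ S ∈ SX.canonicalDiscrete x, ∀ i ∈ X.inertia x, MulAut.conj i • S ∈ SX.canonicalDiscrete x
  saturated_integral : ∀ S ∈ SX.canonicalIntegral x, ∀ i ∈ X.inertia x,
    MulAut.conj i • S ∈ SX.canonicalIntegral x

/-- **Def. 4.1 (iii), the canonical tame integral structure** "which we shall also refer to as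
canonical": the tame structure induced (through a realisation `τ` of the tame quotient) by the canonical
integral structure. [cite: MochizukiGalSect2005, Def 4.1 (iii) p.34] -/
def canonicalTameIntegral {A : Type*} [Group A] (τ : KxHat X →* A) (SX : CuspidalStructures X) :
    Set (T.ATorsor τ) :=
  T.tameOf τ (unitsHat X) (classesOf (SX.canonicalIntegral x))

/-- **Def. 4.1 (iii), the canonical tame discrete structure**. [cite: MochizukiGalSect2005, Def 4.1 (iii) p.34] -/
def canonicalTameDiscrete {A : Type*} [Group A] (τ : KxHat X →* A) (SX : CuspidalStructures X) :
    Set (T.ATorsor τ) :=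
  T.tameOf τ (discreteHat X) (classesOf (SX.canonicalDiscrete x))

/-- A `μ_n(K)`-**torsor structure at `x` compatible with the canonical integral structure** (the notion
Cor. 4.12 and [EtTh] Thm. 1.10 (iii) conclude with: "an even finer reduction of structure group", p.43):
a `μ_n(K)`-orbit of splitting classes contained in the canonical integral structure.
[cite: MochizukiGalSect2005, Cor 4.12 p.43] -/
def IsRootTorsorStructure (SX : CuspidalStructures X) (n : ℕ) (R : Set (SplittingClass X x)) : Prop :=
  T.IsStructure ((rootsOfUnityK X n).map (toKxHat X)) R ∧ R ⊆ classesOf (SX.canonicalIntegral x)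

end CuspidalTorsorData

/-- ORIGIN hypotheses (extending L3's `AbsolutenessOrigin`; threaded as a parameter, never constructed):
"`T` IS the torsor of splittings at `x` with its `(K^×)^∧ ≅ H¹(G_K, Ẑ(1))`-structure of [GalSect] §4".
[cite: MochizukiGalSect2005, §4 p.33] -/
structure CuspidalTorsorOrigin (p : ℕ) [Fact p.Prime] extends AbsolutenessOrigin p where
  /-- genuine torsor data at a cusp -/
  IsTorsorOrigin : ∀ {X : TemperedCurve p} {x : X.Pt}, CuspidalTorsorData X x → Prop

/-! ### Corollary 4.12 (The case of once-punctured elliptic curves) — NAMED FACT, never asserted -/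

/-- Transport of a set of splitting classes along an automorphism `α` of the PROFINITE `Π_{X_K}` fixing
`D̂_x` up to the conjugation `γ` ("preserved by arbitrary automorphisms of `Π_{X_K}`", Cor. 4.12; read as
L3 reads Def. 4.1 (iv): on the closures of images of the member subgroups, `TemperedCurve.hatOf`).
[cite: MochizukiGalSect2005, Cor 4.12 p.43] -/
def PreservedByHat {X : TemperedCurve p} {x : X.Pt} (R : Set (SplittingClass X x))
    (α : X.PiHat ≃ₜ* X.PiHat) (γ : ConjAct X.PiHat) : Prop :=
  (fun S => S.map α.toMulEquiv.toMonoidHom) '' X.hatOf (subgroupsOf R) =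
    (fun S => γ • S) '' X.hatOf (subgroupsOf R)

/-- **[GalSect] Corollary 4.12 (The case of once-punctured elliptic curves)**, p.43, WITH THE ERRATUM of
[EtTh] Rmk. 1.10.1 (ii) ("the author omitted the hypothesis that '`K` contain a primitive 12-th root of
unity'"): "Let `X_K` be a once-punctured elliptic curve over a local field `K` of residue characteristic
`≠ 2` [containing a primitive 12-th root of unity]. Suppose that `X_K` has stable reduction over `O_K`.
… Then there exists a `μ₁₂(K)`-torsor structure at the unique cusp `x` of `X_K` which is compatible with
the canonical integral structure arising from the stable model `X^log` and, moreover, is preserved by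
arbitrary automorphisms of `Π_{X_K}`."  NAMED FACT (a `Prop` OVER THE ORIGIN PARAMETER `Ω`, exactly as
L3's `TemperedAbsolutenessHolds Ω` — v2, lane-D finding D10-F3 (1): with `Ω` bound inside, a trivially-true
origin would have certified junk data, i.e. MORE than print; NEVER asserted; a published, refereed
prerequisite OUTSIDE the [IUTchIII] Cor. 3.12 cone, typed after the FACT-LIST freeze ⇒ recorded in
plan/GAP-LEDGER.md (G-w5d062-1) and not consumable by the adjudication); over genuine data only (origin
predicates).  The unique cusp of a once-punctured elliptic curve over `K` is `K`-RATIONAL: hypothesis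
`X.IsRationalPt x` (v2, D10-F3 (2); it is the key of L3's `CuspidalStructures.canonicalIntegral_nonempty`,
without which the canonical integral structure at a junk non-rational cusp may be empty).
"Preserved" is read as: every `α ∈ Aut(Π_{X_K})` carries `D̂_x` to a conjugate `γ D̂_x γ⁻¹` (cusps are
absolute, [GalSect] Thm. 1.3 (iii)) and the transported structure is the `γ`-conjugate one.
[cite: MochizukiGalSect2005, Cor 4.12 p.43] [cite: MochizukiGalSectComments2014, item (2)]
[cite: MochizukiEtTh2009, Rmk 1.10.1 (ii) p.30] -/
def GalSectCor412 (Ω : CuspidalTorsorOrigin p) : Prop :=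
  ∀ (X : TemperedCurve p) (SX : CuspidalStructures X) (aX : TemperedCurve.CurveArithmeticFlags X)
    (x : X.Pt) (T : CuspidalTorsorData X x),
    Ω.IsHyperbolicCurveOrigin X → Ω.IsStructuresOrigin SX → Ω.IsFlagsOrigin aX → Ω.IsTorsorOrigin T →
    aX.IsOncePuncturedElliptic → p ≠ 2 → (∃ ζ : X.K, IsPrimitiveRoot ζ 12) → SX.HasStableReduction →
    X.IsCusp x → X.IsRationalPt x →
      ∃ R : Set (SplittingClass X x), T.IsRootTorsorStructure SX 12 R ∧
        ∀ (α : X.PiHat ≃ₜ* X.PiHat) (γ : ConjAct X.PiHat),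
          (X.decompHat x).map α.toMulEquiv.toMonoidHom = γ • X.decompHat x → PreservedByHat R α γ

end GalSect

/-! ### [EtTh] Prop. 1.4 (iii), the CUSP clause (p.248 = PDF p.22) -/

namespace ThetaSetting

variable {p : ℕ} [Fact p.Prime] {D : ThetaSetting p}

/-- A `K̈`-rational **cuspidal point** `y ∈ Ÿ(K̈)` through the interface, with "a section `G_L → D_y`
compatible with the canonical integral structure [cf. [Mzk13], Definition 4.1, (iii)] on `D_y`" ([EtTh]
Prop. 1.4 (iii), p.248, `L = K̈`): the decomposition group `D_y = D_{x̃} ∩ Π^tp_Ÿ` cut out of a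
`Π^tp_X`-conjugate `D_{x̃}` of the decomposition group of a cusp of `X` (the cusps of `Ÿ` lie over the cusp
of `X`; `Ÿ → X` is étale there), its coordinate `Ü(y) = ±q̈^a` (the cusps of `Ÿ` are the zeros of `Θ̈`,
Prop. 1.4 (i); tree: `thetaDdot_zpow` / `thetaDdot_neg_zpow`), the image `S = s(G_K̈)` of the section, the
canonical integral structure on `D_y` it belongs to (DATA: [GalSect] Def. 4.1 (iii) for `Ÿ` over `K̈` at
`y`; no carrier for `Ÿ` as a curve — TODO-merge with `GalSect.CuspidalTorsorData` of `X` at the cusp via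
the étale covering), and the evaluation `H¹(S, Δ_Θ) ≅ H¹(G_K̈, Δ_Θ) ≅ (K̈^×)^∧` normalised on Kummer classes
of constants (as `NonCuspidalPoint.evalAt`).  DATA; READING NOTE R3 (`L = K̈`).
[cite: MochizukiEtTh2009, Prop 1.4 (iii) p.22] -/
structure CuspidalPointDd (E : D.KummerData) where
  /-- The decomposition group `D_y ⊆ Π^tp_Ÿ` of the cusp `y`. -/
  Dpt : Subgroup D.PiTemp
  /-- `D_y ≤ Π^tp_Ÿ`. -/
  Dpt_le : Dpt ≤ D.GtpYdd
  /-- The cusp of `X` under `y` … -/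
  cusp : D.Pt
  /-- … is a cusp … -/
  cusp_isCusp : D.IsCusp cusp
  /-- … and `D_y = D_{x̃} ∩ Π^tp_Ÿ` for the conjugate `D_{x̃} = g D_x g⁻¹` of its decomposition group. -/
  conj : D.PiTemp
  Dpt_eq : Dpt = (MulAut.conj conj • D.decomp cusp) ⊓ D.GtpYdd
  /-- `y` is `K̈`-rational: `D_y` maps onto `G_K̈`. -/
  map_aug_Dpt : Dpt.map D.aug.toMonoidHom = D.GKdd
  /-- The coordinate `Ü(y) ∈ K̈^×` of the cusp … -/
  coord : (↥D.Kdd)ˣ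
  /-- … a zero of `Θ̈`: `Ü(y) = ±q̈^a` (Prop. 1.4 (i)). -/
  coord_eq : ∃ a : ℤ, ((coord : D.Kdd) : PadicAlgCl p) = D.qdd ^ a ∨
    ((coord : D.Kdd) : PadicAlgCl p) = -(D.qdd ^ a)
  /-- The image `S = s(G_K̈) ⊆ D_y` of the chosen section … -/
  sec : Subgroup D.PiTemp
  /-- … `S ≤ D_y` … -/
  sec_le : sec ≤ Dpt
  /-- … closed … -/
  isClosed_sec : IsClosed (sec : Set D.PiTemp)
  /-- … meeting the inertia `I_y = D_y ∩ Δ^tp_X` trivially … -/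
  sec_inf : sec ⊓ D.DeltaTemp = ⊥
  /-- … with `S · I_y = D_y`. -/
  sec_sup : sec ⊔ (Dpt ⊓ D.DeltaTemp) = Dpt
  /-- The canonical integral structure on `D_y` ([GalSect] Def. 4.1 (iii) for `Ÿ/K̈` at `y`), as a set of
  images of sections (DATA). -/
  canonicalIntegralDd : Set (Subgroup D.PiTemp)
  /-- The section is "compatible with the canonical integral structure". -/
  sec_mem : sec ∈ canonicalIntegralDd
  /-- Evaluation at `y` through the section: `H¹(S, Δ_Θ) → (K̈^×)^∧` (`S ≅ G_K̈`; Kummer). -/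
  evalAt : D.H1 sec →* E.KddHat
  /-- Evaluation of (the restriction of) the Kummer class of a constant `c ∈ (K̈^×)^∧` returns `c`. -/
  evalAt_kum : ∀ c : E.KddHat,
    evalAt (ContH1.res D.toTheta D.DeltaTheta (sec_le.trans Dpt_le)
      (D.inflTheta D.GtpYdd (E.kumYdd c))) = c

/-- The **leading coefficient of `Θ̈` at the cusp with coordinate `c = Ü(y)`** in the canonical coordinate
`t = Ü/c − 1` of the stable model: `c · Θ̈′(c)` (READING NOTE R2; `‖c · Θ̈′(c)‖ = ‖2‖·‖q̈‖^{−a²}` for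
`c = ±q̈^a` by abc-iut-L2-t6's `norm_deriv_thetaDdot_zpow`). [cite: MochizukiEtTh2009, Prop 1.4 (iii) p.22] -/
def cuspLeadingCoeff (D : ThetaSetting p) (c : PadicAlgCl p) : PadicAlgCl p :=
  c * deriv (thetaDdot D.qdd) c

/-- **[EtTh] Prop. 1.4 (iii), cusp clause** (p.248 = PDF p.22): "A similar statement holds if `y ∈ Ÿ(L)` is
a cusp, if one restricts first to the associated decomposition group `D_y` and then to a section `G_L → D_y`
compatible with the canonical integral structure [cf. [Mzk13], Definition 4.1, (iii)] on `D_y`" — i.e. the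
classes `O^×_K̈ · η̈^Θ`, so restricted, "lie in `L^× ⊆ (L^×)^∧` and are equal to the values" of the
`O^×_K̈`-multiples of `Θ̈` at `y`, the value at a cusp being the leading coefficient `cuspLeadingCoeff`
(READING NOTES R2, R3; `L = K̈`).  Companion of `Prop14iiiValues` (non-cuspidal points).
[cite: MochizukiEtTh2009, Prop 1.4 (iii) p.22] -/
def Prop14iiiCuspValues (E : D.EtaleThetaData) : Prop :=
  ∀ (y : CuspidalPointDd E.toKummerData) (x : D.H1 D.GtpYdd), x ∈ E.thetaClasses →
    ∃ (a : (↥D.Kdd)ˣ) (_ : a ∈ D.unitsOKdd) (v : (↥D.Kdd)ˣ),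
      ((v : D.Kdd) : PadicAlgCl p) = cuspLeadingCoeff D ((y.coord : D.Kdd) : PadicAlgCl p) ∧
      y.evalAt (ContH1.res D.toTheta D.DeltaTheta (y.sec_le.trans y.Dpt_le) x) = E.toKddHat (a * v)

end ThetaSetting

/-! ### [EtTh] Thm. 1.10 (iii) (p.256 = PDF p.30) -/

namespace MuTwoSetting

variable {p : ℕ} [Fact p.Prime] (M : MuTwoSetting p)

/-- **The torsor at the unique cusp of `Ċ^log`** ([EtTh] Thm. 1.10 (iii); [GalSect] §4 applied to the
orbicurve `Ċ = Ẋ/⟨ε_± ε_μ⟩` of type `(1, μ₂)±`, Def. 1.7): the decomposition group `D ⊆ Π^tp_Ċ` of the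
cusp (through which the cusp of `X` factors: `D ∩ Π^tp_X` is a conjugate of `D_x`), its inertia
`I = D ∩ Δ`, the torsor of `I`-conjugacy classes of splittings of `D ↠ G_K` as a set with a simply
transitive action of `(K^×)^∧ ⊇ K^× ∋ −1`, and the canonical integral structure ([GalSect] Def. 4.1 (iii))
as a subset.  DATA over `MuTwoSetting` (no carrier for `Ċ` as an orbicurve; `K = K̈` by Def. 1.7 (I)).
[cite: MochizukiEtTh2009, Thm 1.10 (iii) p.30] -/
structure DotCCuspTorsor (εZ : M.GtpC) : Type 1 where
  /-- The decomposition group of the unique cusp of `Ċ`, inside `Π^tp_Ċ ≤ Π^tp_C`. -/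
  Dc : Subgroup M.GtpC
  /-- `D ≤ Π^tp_Ċ`. -/
  Dc_le : Dc ≤ M.dotC εZ
  /-- the cusp of `X` below: `D ∩ Π^tp_X = g D_x g⁻¹` for a cusp `x` of `X` … -/
  cusp : M.Pt
  cusp_isCusp : M.IsCusp cusp
  conj : M.PiTemp
  Dc_inf_range : Dc ⊓ M.inclX.range = (MulAut.conj conj • M.decomp cusp).map M.inclX
  /-- The splittings of `D ↠ G_K` modulo `I`-conjugation: the underlying set of the torsor … -/
  Cls : Type
  /-- … and the class of a splitting subgroup `S ≤ D` (`S` closed, `S ∩ I = 1`, `S·I = D`,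
  `I = D ∩ (Δ^tp_C := ` the normal closure image of `Δ^tp_X`); junk outside splittings). -/
  cls : Subgroup M.GtpC → Cls
  /-- the torsor action of `(K^×)^∧` (`GalSect.KxHat`, the profinite completion of `K^×`) on the
  splitting classes … -/
  act : GalSect.KxHat M.toThetaSetting.toTemperedCurve → Cls → Cls
  act_one : ∀ c, act 1 c = c
  act_mul : ∀ k k' c, act (k * k') c = act k (act k' c)
  /-- … free and transitive. -/
  existsUnique_act_eq : ∀ c c' : Cls, ∃! k, act k c = c'
  /-- The canonical integral structure on `D` ([GalSect] Def. 4.1 (iii)), as a set of classes … -/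
  canonicalIntegral : Set Cls
  /-- … which is an `O_K^×`-STRUCTURE: the `O_K^×`-orbit of each of its members (v3 LAW, [GalSect]
  Def. 4.1 (iii); audit F-w5d016-g3-1). -/
  canonicalIntegral_isStructure : ∃ c ∈ canonicalIntegral, canonicalIntegral =
    {c' | ∃ u ∈ GalSect.unitsHat M.toThetaSetting.toTemperedCurve, c' = act u c}

namespace DotCCuspTorsor

variable {M} {εZ : M.GtpC} (C : M.DotCCuspTorsor εZ)

/-- `−1 ∈ K^×`. [cite: MochizukiEtTh2009, Thm 1.10 (iii) p.30] -/
def negOne : (↥M.K)ˣ := -1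

/-- A **`{±1}`-structure** on the `(K^×)^∧`-torsor at the cusp of `Ċ` **compatible with the canonical
integral structure**: a `{±1}`-orbit `{c, (−1)·c}` of splitting classes inside the canonical integral
structure ([GalSect] Def. 4.1 (i) with `B = {±1} ⊆ O_K^×`). [cite: MochizukiEtTh2009, Thm 1.10 (iii) p.30] -/
def IsPMStructure (R : Set C.Cls) : Prop :=
  (∃ c ∈ R, R = {c, C.act (GalSect.toKxHat M.toThetaSetting.toTemperedCurve negOne) c}) ∧
    R ⊆ C.canonicalIntegral

/-- The splitting subgroups of `D` whose class lies in `R`. [cite: MochizukiEtTh2009, Thm 1.10 (iii) p.30] -/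
def members (R : Set C.Cls) : Set (Subgroup M.GtpC) :=
  {S | S ≤ C.Dc ∧ C.cls S ∈ R}

end DotCCuspTorsor

end MuTwoSetting

section Thm110iii

variable {p : ℕ} [Fact p.Prime] {Mα Mβ : MuTwoSetting p} {εα : Mα.GtpC} {εβ : Mβ.GtpC}
  {hCα : Mα.toThetaSetting.Compat} {hCβ : Mβ.toThetaSetting.Compat}
  {Eα : Mα.toThetaSetting.EtaleThetaData} {Eβ : Mβ.toThetaSetting.EtaleThetaData}
  {γ : Mα.dotC εα ≃ₜ* Mβ.dotC εβ}

/-- **[EtTh] Thm. 1.10 (iii)** (p.256 = PDF p.30): "Suppose that `η̈^{Θ,Z}_☐` is of standard type, and that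
the residue characteristic of `K_☐` is odd. Then `η̈^{Θ,Z}_☐` determines a `{±1}`-structure [cf. [Mzk13],
Corollary 4.12; Remark 1.10.1, (ii)] on the `(K^×_☐)^∧`-torsor at the unique cusp of `Ċ^log_☐` that is
compatible with the canonical integral structure and, moreover, preserved by `γ`."  Typed, in the style of
`Thm110i/ii`, as a property of the pair under `Thm110Hypothesis` (so "determines" = existence on both sides
+ transport): for `p` odd and both orbits of standard type there are `{±1}`-structures `Rα`, `Rβ` compatible
with the canonical integral structures whose member splittings correspond under the extension `Γ` of `γ`
to `Π^tp_C` (Prop. 1.8; `Γ` maps `D_α` to a `Π^tp_{Ċβ}`-conjugate of `D_β`).  Print derives (iii)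
"formally from (ii)" via Prop. 1.4. [cite: MochizukiEtTh2009, Thm 1.10 (iii) p.30] -/
def Thm110iii (H : Thm110Hypothesis εα εβ hCα hCβ Eα Eβ γ)
    (Sα : Mα.StandardData Eα.toKummerData) (Sβ : Mβ.StandardData Eβ.toKummerData)
    (Cα : Mα.DotCCuspTorsor εα) (Cβ : Mβ.DotCCuspTorsor εβ) : Prop :=
  Odd p → Mα.IsOfStandardType hCα εα Sα Eα.etaDd → Mβ.IsOfStandardType hCβ εβ Sβ Eβ.etaDd →
    ∃ (Rα : Set Cα.Cls) (Rβ : Set Cβ.Cls), Cα.IsPMStructure Rα ∧ Cβ.IsPMStructure Rβ ∧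
      ∃ c : Mβ.GtpC, c ∈ Mβ.dotC εβ ∧
        Cα.Dc.map H.Γ.toMulEquiv.toMonoidHom = MulAut.conj c • Cβ.Dc ∧
        (fun S => S.map H.Γ.toMulEquiv.toMonoidHom) '' Cα.members Rα =
          (fun S => MulAut.conj c • S) '' Cβ.members Rβ

end Thm110iii

end Literature.AnabelianGeometry.EtaleTheta

end

-- enqueue re-land 2026-08-26T07:28Z (stranded accept p425300, no content change; filed by abc-iut-L6-d5 for the owner abc-iut-w5-d062 on abc-iut-L2-lead GO 07:2xZ)
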